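import Summits.CriticalPhenomena.PercolationContinuityZ3.Theorems.PercNearOneGluingNoHeavyQuantGatedSliceMixLawPooled
import HarnessLib

/-!
# QUANT lane R8, T-DEC, leg (III), blob case — `LawDec.GatedSliceMixLaw'` in REGIME B, cell B-M with TWO mids: the top `k₂` of the
# two-point law a mid BELOW the weak-mid atom (`k₂ < h ≤ j`), `k₂` SATURATED by the shifted low — the overflow rides `W_h`'s mid

builds on p205010 (kernel theorem, internal audit signed; external expert review pending)

Support file (`--supports stmt-CriticalPhenomena-4575`), QUANT lane seat prim-quant-census-2 (gen 61), rung R8 of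
`run/shared/lean/prim/quant/LADDER.md`.  Memo `run/shared/lean/prim/quant/prim-quant-census-2-g61/REGIME-B-TOP-G61.md` §5.  Theorems only,
standard axioms, no sorries.  Tools: `…QuantGatedSliceMixLawPooled` (`pooled_dear`, `pooled_cheap`, `usage_mid_le_of_rho_le`),
`…QuantGatedSliceMixLawExchange` (`flowAtT_pair`, `movedTwoPoint_apply`, `gatedSliceMixLaw_conclusion_of_flowAtT`), `flowAtT_of_giants`.

THE CELL.  Frame of `GatedSliceMixLaw'` in regime B (`h + a ≥ j+1`) with `k₂` a mid (`k₂ ≤ j`, `t ≤ 2k₂`), `k₂ + a ≥ j+1`, `k₂ < h`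
(so the mixture has TWO mids `k₂ < h` and two giants `k₂ + a < h + a`; only for `a ≥ 2`), `k₁` and `ℓ = k₁ + a` `t`-lows, `g < 1`, and the
moved law's own mid SATURATED by the shifted low: `m₂ ≤ U(ℓ,k₂)·m₁'`.  Certificate (LP pattern `ℓ → k₂, ℓ → h, k₁ → h | giants`, exact census
of the seat: 1 030 instances of the sub-cell, 93 genuine, 0 exceptions): `ℓ` fills `k₂` exactly, its overflow `N_ℓ = m₁' − m₂/U(ℓ,k₂)` rides
`W_h`'s mid `h` (cheaper than `k₂` since `h > k₂`), `k₁` rides `h` when cheap there and the giants otherwise, every zero rides the giants;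
`θ = D/(D + W(h))` with `D = U(ℓ,h)N_ℓ + [cheap]·U(k₁,h)m₁`.  The giant inequality reduces, through `u·W(0) − W(h+a) ≤ W(h)` (`y·h ≤ S`), to
`U(ℓ,h)N_ℓ + min(u, U(k₁,h))m₁ + uz ≤ m₂'`, which FOLLOWS from the pooled inequality of the pair `(k₁, k₂)` (`pooled_dear` / `pooled_cheap`
with the top `k₂`: `U(ℓ,k₂)m₁' + min(u,U(k₁,k₂))m₁ + uz ≤ m₂ + m₂'`) because usage decreases with the height of the mid (`usage_mid_le_of_rho_le`).
(The mirror sub-cell `h < k₂` needs a new inequality — not here.)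

* `LawDec.flowAtT_lows_giants₂` — criterion E for a zero, one nonzero low and two giant atoms (bookkeeping).
* `LawDec.usage_le_giant_of_light` — a light pair costs at most the giant rate: `t − 2l ≤ y(m − l)` ⟹ `usage y t j l m ≤ y/(1−y)`.
* **`LawDec.gatedSliceMixLaw_regimeB_twoMid_dear`** — the conclusion of `GatedSliceMixLaw'` on the sub-cell `k₂ < h`, `m₂ ≤ U(ℓ,k₂)m₁'`,
  `k₁` dear at `h`; the cheap twin `gatedSliceMixLaw_regimeB_twoMid_cheap` is the companion `…QuantGatedSliceMixLawRegimeBTwoMidCheap`.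

[this work]; exchange architecture: prim-quant-stmt g30; flow form / criterion E: prim-quant-stmt g22–g27, arm-1 g39; kink map: arm-3 g63–g64,
lead g31–g32 (this lane).  Nothing here is cited as a published result.  The gluing rows served [cite: KozmaNitzan2024, Conjecture 3 (p. 15)];
product measure [cite: Grimmett1999, §1.3 p. 10].
-/

noncomputable section

namespace Summit.CriticalPhenomena.PercolationContinuityZ3.Theorems

namespace Quant

open Finset

/-- the two-point law `{lo, hi; g}` (as in `…QuantLawDEC`) -/
local notation3 "TP[" lo ", " hi ", " g ", " h "]" =>
  (g : ℝ) * (if (h : ℕ) = (hi : ℕ) then (1 : ℝ) else 0) + (1 - (g : ℝ)) * (if (h : ℕ) = (lo : ℕ) then (1 : ℝ) else 0)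

namespace LawDec

/-! ### Bookkeeping: the zero and one low ride two giant atoms -/

/-- **criterion E for `c₀·δ₀ + c₁·δ_{k₁} + G₁·δ_{p₁} + G₂·δ_{p₂}`** with `k₁ ≤ j` a `t`-low (`2k₁ < t`), `p₁, p₂ ∈ (j, N]` giants
(possibly equal), nonnegative masses and `y/(1−y)·(c₀ + c₁) ≤ G₁ + G₂`. [this work] -/
theorem flowAtT_lows_giants₂ (y t : ℝ) (j N k₁ p₁ p₂ : ℕ) (c₀ c₁ G₁ G₂ : ℝ) (hy0 : 0 < y) (hy1 : y < 1)
    (hc₀ : 0 ≤ c₀) (hc₁ : 0 ≤ c₁) (hG₁ : 0 ≤ G₁) (hG₂ : 0 ≤ G₂) (hk₁j : k₁ ≤ j) (hk₁low : 2 * (k₁ : ℝ) < t)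
    (hp₁ : j + 1 ≤ p₁) (hp₁N : p₁ ≤ N) (hp₂ : j + 1 ≤ p₂) (hp₂N : p₂ ≤ N)
    (hE : y / (1 - y) * (c₀ + c₁) ≤ G₁ + G₂) :
    FlowAtT y t j N (fun p => c₀ * (if p = 0 then (1 : ℝ) else 0) + c₁ * (if p = k₁ then (1 : ℝ) else 0)
      + G₁ * (if p = p₁ then (1 : ℝ) else 0) + G₂ * (if p = p₂ then (1 : ℝ) else 0)) := by
  classical
  refine flowAtT_of_giants y t j N _ hy0 hy1 (fun p => ?_) ?_
  · refine add_nonneg (add_nonneg (add_nonneg (mul_nonneg hc₀ ?_) (mul_nonneg hc₁ ?_)) (mul_nonneg hG₁ ?_)) (mul_nonneg hG₂ ?_) <;>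
      split_ifs <;> norm_num
  · have hl : ∑ l ∈ Finset.range (j + 1), (if 2 * (l : ℝ) < t then
        c₀ * (if l = 0 then (1 : ℝ) else 0) + c₁ * (if l = k₁ then (1 : ℝ) else 0)
          + G₁ * (if l = p₁ then (1 : ℝ) else 0) + G₂ * (if l = p₂ then (1 : ℝ) else 0) else 0) = c₀ + c₁ := by
      have e : ∀ l ∈ Finset.range (j + 1), (if 2 * (l : ℝ) < t then
          c₀ * (if l = 0 then (1 : ℝ) else 0) + c₁ * (if l = k₁ then (1 : ℝ) else 0)
            + G₁ * (if l = p₁ then (1 : ℝ) else 0) + G₂ * (if l = p₂ then (1 : ℝ) else 0) else 0)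
          = c₀ * (if l = 0 then (1 : ℝ) else 0) + c₁ * (if l = k₁ then (1 : ℝ) else 0) := by
        intro l hl
        have hl' : l ≤ j := Nat.lt_succ_iff.1 (Finset.mem_range.1 hl)
        rw [if_neg (show l ≠ p₁ by omega), if_neg (show l ≠ p₂ by omega)]
        by_cases hl0 : l = 0
        · subst hl0
          have hk0 : (0 : ℝ) ≤ ((0 : ℕ) : ℝ) := Nat.cast_nonneg 0
          rw [if_pos (by push_cast at hk₁low ⊢; linarith)]; ring
        · by_cases hl1 : l = k₁
          · subst hl1; rw [if_pos hk₁low]; ring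
          · rw [if_neg hl0, if_neg hl1]; split_ifs <;> ring
      rw [Finset.sum_congr rfl e, Finset.sum_add_distrib, sum_mul_indicator (fun _ => c₀) j 0 (by omega),
        sum_mul_indicator (fun _ => c₁) j k₁ hk₁j]
    have hg' : ∑ p ∈ Finset.Ico (j + 1) (N + 1),
        (c₀ * (if p = 0 then (1 : ℝ) else 0) + c₁ * (if p = k₁ then (1 : ℝ) else 0)
          + G₁ * (if p = p₁ then (1 : ℝ) else 0) + G₂ * (if p = p₂ then (1 : ℝ) else 0)) = G₁ + G₂ := by
      have e : ∀ p ∈ Finset.Ico (j + 1) (N + 1),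
          (c₀ * (if p = 0 then (1 : ℝ) else 0) + c₁ * (if p = k₁ then (1 : ℝ) else 0)
            + G₁ * (if p = p₁ then (1 : ℝ) else 0) + G₂ * (if p = p₂ then (1 : ℝ) else 0))
            = G₁ * (if p = p₁ then (1 : ℝ) else 0) + G₂ * (if p = p₂ then (1 : ℝ) else 0) := by
        intro p hp
        have hpj := (Finset.mem_Ico.1 hp).1
        rw [if_neg (show p ≠ 0 by omega), if_neg (show p ≠ k₁ by omega)]; ring
      rw [Finset.sum_congr rfl e, Finset.sum_add_distrib, ← Finset.mul_sum, ← Finset.mul_sum,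
        Finset.sum_ite_eq' (Finset.Ico (j + 1) (N + 1)) p₁, if_pos (Finset.mem_Ico.2 ⟨hp₁, by omega⟩),
        Finset.sum_ite_eq' (Finset.Ico (j + 1) (N + 1)) p₂, if_pos (Finset.mem_Ico.2 ⟨hp₂, by omega⟩)]
      ring
    rw [hl, hg']
    exact hE

/-! ### A light pair costs at most the giant rate -/

/-- **`usage y t j l m ≤ y/(1−y)` for a light pair**: `m ≤ j`, `2l < t < l + m`, `t − 2l ≤ y(m − l)`, `0 < y < 1`. [this work] -/
theorem usage_le_giant_of_light (y t : ℝ) (j l m : ℕ) (hy0 : 0 < y) (hy1 : y < 1) (hmj : m ≤ j) (hlow : 2 * (l : ℝ) < t)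
    (hcomp : t < (l : ℝ) + m) (hlight : t - 2 * (l : ℝ) ≤ y * ((m : ℝ) - l)) :
    usage y t j l m ≤ y / (1 - y) := by
  rw [usage_eq_light' y t j l m hy0 hy1 hmj hlow hcomp hlight]
  have h1y : 0 < 1 - y := by linarith
  have hE : 0 < (1 - y) * ((1 - y) * (l : ℝ) + (1 + y) * m - t) := by apply mul_pos h1y; nlinarith
  rw [div_le_div_iff₀ hE h1y]
  have hl0 : (0 : ℝ) ≤ l := Nat.cast_nonneg l
  nlinarith [mul_nonneg h1y.le (sub_nonneg.2 hlight), mul_nonneg h1y.le hl0]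

/-! ### Regime B, two mids `k₂ < h`, `k₂` saturated by the shifted low -/

set_option maxHeartbeats 1600000 in
/-- **REGIME B, TWO MIDS `k₂ < h`, `k₂` SATURATED, DEAR `k₁` — the conclusion of `GatedSliceMixLaw'`.**  Frame of `MixLawRegimeB` with
`k₂ ≤ j` a mid (`t ≤ 2k₂`), `k₂ < h`, `ℓ = k₁ + a` a `t`-low, `g < 1`, `k₁` dear at `h` (`y(h − k₁) ≤ t − 2k₁`), and `m₂ ≤ U(ℓ,k₂)·m₁'`.
Flow: `ℓ` fills `k₂`, its overflow fills `θ·W(h)` at rate `U(ℓ,h)`, `k₁` and the zeros ride the giants `h + a`, `k₂ + a`;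
`θ = D/(D + W(h))`, `D = U(ℓ,h)·(m₁' − m₂/U(ℓ,k₂))`; giant inequality from `pooled_dear` (top `k₂`) and `U(ℓ,h) ≤ U(ℓ,k₂)`. [this work] -/
theorem gatedSliceMixLaw_regimeB_twoMid_dear (y z g S lam : ℝ) (a j M h k₁ k₂ : ℕ)
    (hy0 : 0 < y) (hy1 : y < 1) (hz0 : 0 ≤ z) (hz1 : z < 1) (hg1 : g < 1) (hyg : y ≤ (1 - z) * g)
    (hS0 : 0 < S) (hta : y * (M : ℝ) ≤ S) (hhj : h ≤ j) (hhM : h ≤ M) (hSh : S < (h : ℝ))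
    (hk : k₁ ≤ k₂) (hk₂M : k₂ ≤ M) (hlam0 : 0 ≤ lam) (hlam1 : lam ≤ 1)
    (hmean : (1 - z) * ((k₁ : ℝ) + ((k₂ : ℝ) - k₁) * lam) = S)
    (hk₁j : k₁ ≤ j) (hk1low : 2 * (k₁ : ℝ) < S + (a : ℝ) * g * (1 - z))
    (hllow : 2 * ((k₁ + a : ℕ) : ℝ) < S + (a : ℝ) * g * (1 - z)) (hlj : k₁ + a ≤ j) (hk₂aG : j + 1 ≤ k₂ + a) (hhaG : j + 1 ≤ h + a)
    (hk₂j : k₂ ≤ j) (hk₂mid : S + (a : ℝ) * g * (1 - z) ≤ 2 * (k₂ : ℝ)) (hk₂h : k₂ < h)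
    (hdear : y * ((h : ℝ) - k₁) ≤ S + (a : ℝ) * g * (1 - z) - 2 * (k₁ : ℝ))
    (hsat : (1 - z) * lam * (1 - g) ≤ usage y (S + (a : ℝ) * g * (1 - z)) j (k₁ + a) k₂ * ((1 - z) * (1 - lam) * g)) :
    ∃ θ : ℝ, 0 ≤ θ ∧ θ < 1 ∧
      DECAtT y (S + (a : ℝ) * g * (1 - z)) j (M + a)
        (fun p => θ * weakMidLaw S g h a p
          + (1 - θ) * (z * (if p = 0 then (1 : ℝ) else 0) + (1 - z) * slice (fun q => TP[k₁, k₂, lam, q]) a g p)) := by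
  classical
  set t : ℝ := S + (a : ℝ) * g * (1 - z) with ht
  have h1z : 0 < 1 - z := by linarith
  have hg0 : 0 < g := by nlinarith
  have h1y : 0 < 1 - y := by linarith
  have ha0 : (0 : ℝ) ≤ a := Nat.cast_nonneg a
  have hk0 : (0 : ℝ) ≤ k₁ := Nat.cast_nonneg k₁
  have hh0 : (0 : ℝ) < h := lt_trans hS0 hSh
  have hk₂h' : (k₂ : ℝ) < h := by exact_mod_cast hk₂h
  have hyh : y * (h : ℝ) ≤ S := le_trans (mul_le_mul_of_nonneg_left (by exact_mod_cast hhM) hy0.le) hta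
  have hyk₂ : y * (k₂ : ℝ) ≤ S := le_trans (mul_le_mul_of_nonneg_left (by exact_mod_cast hk₂M) hy0.le) hta
  have hlam0' : 0 ≤ 1 - lam := by linarith
  have hagw0 : 0 ≤ (a : ℝ) * g * (1 - z) := mul_nonneg (mul_nonneg ha0 hg0.le) h1z.le
  have hagwa : (a : ℝ) * g * (1 - z) ≤ a := by nlinarith [mul_nonneg ha0 hg0.le]
  have ht0 : 0 < t := by rw [ht]; linarith
  -- masses
  set m₁ : ℝ := (1 - z) * (1 - lam) * (1 - g) with hm₁
  set m₁' : ℝ := (1 - z) * (1 - lam) * g with hm₁'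
  set m₂ : ℝ := (1 - z) * lam * (1 - g) with hm₂
  set m₂' : ℝ := (1 - z) * lam * g with hm₂'
  have hm₁0 : 0 ≤ m₁ := mul_nonneg (mul_nonneg h1z.le hlam0') (by linarith)
  have hm₁'0 : 0 ≤ m₁' := mul_nonneg (mul_nonneg h1z.le hlam0') hg0.le
  have hm₂0 : 0 ≤ m₂ := mul_nonneg (mul_nonneg h1z.le hlam0) (by linarith)
  have hm₂'0 : 0 ≤ m₂' := mul_nonneg (mul_nonneg h1z.le hlam0) hg0.le
  have hΛ : (1 - z) * lam = m₂ + m₂' := by rw [hm₂, hm₂']; ring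
  -- λ < 1 (else m₁' = 0 < m₂ contradicts saturation), hence S < k₂
  have hlam1' : lam < 1 := by
    by_contra hc
    have hl1 : lam = 1 := le_antisymm hlam1 (not_lt.1 hc)
    have e1 : m₁' = 0 := by rw [hm₁', hl1]; ring
    have e2 : m₂ = (1 - z) * (1 - g) := by rw [hm₂, hl1]; ring
    have h3 : m₂ ≤ 0 := by rw [e1, mul_zero] at hsat; exact hsat
    rw [e2] at h3
    nlinarith [mul_pos h1z (show (0:ℝ) < 1 - g by linarith)]
  have hSk₂ : S < (k₂ : ℝ) := by
    have hkk : (0 : ℝ) < (k₂ : ℝ) - k₁ := by linarith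
    have hk₂pos : (0 : ℝ) ≤ k₂ := Nat.cast_nonneg k₂
    have e : (k₂ : ℝ) - S = z * k₂ + (1 - z) * (1 - lam) * ((k₂ : ℝ) - k₁) := by rw [← hmean]; ring
    have p1 : 0 < (1 - z) * (1 - lam) * ((k₂ : ℝ) - k₁) := mul_pos (mul_pos h1z (by linarith)) hkk
    have p2 : 0 ≤ z * (k₂ : ℝ) := mul_nonneg hz0 hk₂pos
    linarith only [e, p1, p2]
  set w₀ : ℝ := 1 - S / h with hw₀
  set Wh : ℝ := S / h * (1 - g) with hWh
  set WG : ℝ := S / h * g with hWG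
  have hSh' : 0 < S / (h : ℝ) := div_pos hS0 hh0
  have hw0 : 0 ≤ w₀ := by rw [hw₀, sub_nonneg, div_le_one hh0]; exact hSh.le
  have hWhpos : 0 < Wh := mul_pos hSh' (by linarith)
  have hWG0 : 0 ≤ WG := mul_nonneg hSh'.le hg0.le
  -- compatibilities
  have hcompk : t < ((k₁ + a : ℕ) : ℝ) + k₂ := by push_cast; rw [ht]; linarith
  have hcomph : t < ((k₁ + a : ℕ) : ℝ) + h := by linarith
  have hlk : k₁ + a < k₂ := by
    have : ((k₁ + a : ℕ) : ℝ) < k₂ := by push_cast at hllow hcompk ⊢; linarith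
    exact_mod_cast this
  have hlh : k₁ + a < h := by omega
  -- rates
  set Ulk : ℝ := usage y t j (k₁ + a) k₂ with hUlk
  set Ulh : ℝ := usage y t j (k₁ + a) h with hUlh
  have hUlkpos : 0 < Ulk := usage_pos_of_compat y t j (k₁ + a) k₂ hy0 hy1 hllow hlk (Or.inr hcompk)
  have hUlhpos : 0 < Ulh := usage_pos_of_compat y t j (k₁ + a) h hy0 hy1 hllow hlh (Or.inr hcomph)
  have hUle : Ulh ≤ Ulk := by
    rw [hUlh, hUlk]
    refine usage_mid_le_of_rho_le y t t j (k₁ + a) (k₁ + a) h k₂ hy0 hy1 hhj hk₂j hllow hcompk ?_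
    have hD1 : (0 : ℝ) < (h : ℝ) - ((k₁ + a : ℕ) : ℝ) := by push_cast; push_cast at hcomph hllow; linarith
    have hD2 : (0 : ℝ) < (k₂ : ℝ) - ((k₁ + a : ℕ) : ℝ) := by push_cast; push_cast at hcompk hllow; linarith
    rw [div_le_div_iff₀ hD1 hD2]
    have : 0 ≤ t - 2 * ((k₁ + a : ℕ) : ℝ) := by linarith
    exact mul_le_mul_of_nonneg_left (by linarith) this
  -- overflow and kink
  set α : ℝ := m₂ / Ulk with hα
  have hα0 : 0 ≤ α := div_nonneg hm₂0 hUlkpos.le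
  have hαU : Ulk * α = m₂ := by rw [hα]; field_simp
  set N : ℝ := m₁' - α with hN
  have hN0 : 0 ≤ N := by rw [hN, hα, sub_nonneg, div_le_iff₀ hUlkpos]; linarith [hsat]
  set D : ℝ := Ulh * N with hD
  have hD0 : 0 ≤ D := mul_nonneg hUlhpos.le hN0
  obtain ⟨θ, hθ⟩ : ∃ q : ℝ, q = D / (D + Wh) := ⟨_, rfl⟩
  have hden : 0 < D + Wh := by linarith
  have hθ0 : 0 ≤ θ := by rw [hθ]; exact div_nonneg hD0 hden.le
  have hθ1 : θ < 1 := by rw [hθ, div_lt_one hden]; linarith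
  have h1θ : 0 < 1 - θ := by linarith
  have hkink : θ * Wh = (1 - θ) * D := by rw [hθ]; field_simp; ring
  -- the giant inequality
  have hu : y / (1 - y) * w₀ - WG ≤ Wh := by
    have h1 : y / (1 - y) * w₀ ≤ S / h := by
      rw [hw₀, show (1 : ℝ) - S / h = ((h : ℝ) - S) / h by field_simp, show y / (1 - y) * (((h : ℝ) - S) / h) = y * ((h : ℝ) - S) / ((1 - y) * h) by
        field_simp, div_le_div_iff₀ (mul_pos h1y hh0) hh0]
      have hx := mul_nonneg hh0.le (sub_nonneg.2 hyh)
      linarith only [hx]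
    have e : S / (h : ℝ) = WG + Wh := by rw [hWG, hWh]; ring
    linarith only [h1, e]
  have hdear_k : y * ((k₂ : ℝ) - k₁) ≤ t - 2 * (k₁ : ℝ) := by
    have : y * (k₂ : ℝ) ≤ y * h := mul_le_mul_of_nonneg_left hk₂h'.le hy0.le
    linarith only [this, hdear]
  have hpool := pooled_dear y z g S lam j k₂ a k₁ hy0 hy1 hz0 hz1.le hg0.le hg1.le hlam1 hk₂j hSk₂ hyk₂ hmean hllow hdear_k
  rw [← hUlk, ← hm₁', ← hm₁, hΛ] at hpool
  have hDle : D + y / (1 - y) * m₁ + y / (1 - y) * z ≤ m₂' := by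
    -- D = Ulh N ≤ Ulk N = Ulk m₁' − m₂
    have h1 : D ≤ Ulk * N := mul_le_mul_of_nonneg_right hUle hN0
    have h2 : Ulk * N = Ulk * m₁' - m₂ := by rw [hN, mul_sub, hαU]
    linarith [hpool, h1, h2]
  have hG : y / (1 - y) * ((θ * w₀ + (1 - θ) * z) + (1 - θ) * m₁) ≤ θ * WG + (1 - θ) * m₂' := by
    have h1 : θ * (y / (1 - y) * w₀ - WG) ≤ θ * Wh := mul_le_mul_of_nonneg_left hu hθ0
    have h2 : D ≤ m₂' - y / (1 - y) * z - y / (1 - y) * m₁ := by linarith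
    have h3 : (1 - θ) * D ≤ (1 - θ) * (m₂' - y / (1 - y) * z - y / (1 - y) * m₁) := mul_le_mul_of_nonneg_left h2 h1θ.le
    linarith [h1, h3, hkink]
  -- pieces
  have Pk := flowAtT_pair y t j (M + a) (k₁ + a) k₂ ((1 - θ) * α) ((1 - θ) * m₂) hlj hllow (by omega) (Or.inr hk₂mid)
    (Or.inr hcompk) (mul_nonneg h1θ.le hα0) (le_of_eq (by rw [← hUlk, ← hαU]; ring))
  have hhmid : t ≤ 2 * (h : ℝ) := by linarith
  have Ph := flowAtT_pair y t j (M + a) (k₁ + a) h ((1 - θ) * N) (θ * Wh) hlj hllow (by omega) (Or.inr hhmid)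
    (Or.inr hcomph) (mul_nonneg h1θ.le hN0) (by rw [← hUlh]; nlinarith [hkink])
  have Pg := flowAtT_lows_giants₂ y t j (M + a) k₁ (h + a) (k₂ + a) (θ * w₀ + (1 - θ) * z) ((1 - θ) * m₁) (θ * WG) ((1 - θ) * m₂')
    hy0 hy1 (add_nonneg (mul_nonneg hθ0 hw0) (mul_nonneg h1θ.le hz0)) (mul_nonneg h1θ.le hm₁0) (mul_nonneg hθ0 hWG0)
    (mul_nonneg h1θ.le hm₂'0) hk₁j hk1low hhaG (by omega) hk₂aG (by omega) (by linarith [hG])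
  -- assemble
  have hsum := FlowAtT.add (FlowAtT.add Pk Ph) Pg
  have hflow : FlowAtT y t j (M + a) (fun p => θ * weakMidLaw S g h a p
      + (1 - θ) * (z * (if p = 0 then (1 : ℝ) else 0) + (1 - z) * slice (fun q => TP[k₁, k₂, lam, q]) a g p)) := by
    refine (congrArg (FlowAtT y t j (M + a)) (funext fun p => ?_)).mp hsum
    rw [movedTwoPoint_apply, ← hm₁, ← hm₁', ← hm₂, ← hm₂']
    unfold weakMidLaw
    rw [← hw₀, ← hWh, ← hWG]
    have eN : (1 - θ) * m₁' = (1 - θ) * α + (1 - θ) * N := by rw [hN]; ring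
    linear_combination (-(if p = k₁ + a then (1 : ℝ) else 0)) * eN
  exact gatedSliceMixLaw_conclusion_of_flowAtT y z g S lam θ a j M h k₁ k₂ hy0 hy1 hhM hk hk₂M hθ0 hθ1 hflow

end LawDec

end Quant

end Summit.CriticalPhenomena.PercolationContinuityZ3.Theorems
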